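import Summits.HodgeConjecture.HodgeConjecture.Theorems.MilnorKExponentialSymbolLiftRCupStepDefs
import HarnessLib

/-!
# Cup step for `SymbolLiftR` (route `MilnorKExponential`), II: Leibniz rules of the Čech–de Rham cup product

Helper file for the stub `stub_cupStep` (S3) of the line `lefschetz-fold` of the crux `SymbolLiftR`
(item stmt-HodgeConjecture-18702). For the cup products `cupZero`, `cupOne` of the companion file
`…CupStepDefs` on the Čech–de Rham complex `CechForms I A U a b = C^a(𝔘, Ω^b)` of
`Literature.Geometry.Kaehler.CechDeRham` (Bott–Tu (1982), §8: the product structure on `C^•(𝔘, Ω^•)`,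
with `D = δ + (-1)^a d` an antiderivation), the Leibniz rules in the closed cases needed for the
product zig-zag: `δ(x ∪ y) = δx ∪ y` for `δy = 0` (`cechδ_cupOne`), `δ(x ∪ y) = x ∪ δy` for a
`δ`-closed `0`-cochain `x` (`cechδ_cupZero`), `cechd (x ∪ y) = -(cechd x) ∪ y` for `dy = 0`
(`cechd_cupOne`, pointwise Leibniz rule of Warner (1983), Thm. 2.20), and the bottom computation
`d(s • rθ ∪ α) = s • θ ∧ dα` (`cechd_smul_cupZero_apply`). Everything is proved; no definitions.

## References

* R. Bott, L. W. Tu, *Differential Forms in Algebraic Topology* (1982), §8 (8.4), Prop. 8.8.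
* F. W. Warner, *Foundations of Differentiable Manifolds and Lie Groups* (1983), 2.6, Thm. 2.20.
-/

noncomputable section

-- the mandated namespace `Summit.HodgeConjecture.HodgeConjecture.…` repeats a component
set_option linter.dupNamespace false

open scoped Manifold ContDiff

namespace Summit.HodgeConjecture.HodgeConjecture.Theorems.SymbolLiftR

open Literature.Geometry.Kaehler Literature.NumberTheory.Transcendental
open Literature.AlgebraicGeometry.Modules

namespace CupStep

section Forms

variable {E : Type*} [NormedAddCommGroup E] [NormedSpace ℝ E] {H : Type*} [TopologicalSpace H]
  {I : ModelWithCorners ℝ E H} {M : Type*} [TopologicalSpace M] [ChartedSpace H M]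
  {A : Type*} [NormedCommRing A] [NormedAlgebra ℝ A] {κ : Type*} {U : κ → Set M}
  (hU : ∀ i, IsOpen (U i))

omit hU in
/-- The wedge of forms with a finite sum on the left (bilinearity, Warner (1983), 2.6).
[cite: WarnerGTM94, 2.6] -/
theorem sum_wedge {k l : ℕ} {β : Type*} (s : Finset β) (f : β → MForm I M A k) (g : MForm I M A l) :
    (∑ i ∈ s, f i).wedge g = ∑ i ∈ s, (f i).wedge g := by
  classical
  induction s using Finset.induction_on with
  | empty => rw [Finset.sum_empty, Finset.sum_empty, MForm.zero_wedge]
  | insert i s hi ih => rw [Finset.sum_insert hi, Finset.sum_insert hi, MForm.wedge_add_left, ih]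

omit hU in
/-- The wedge of forms with a negative on the right. [cite: WarnerGTM94, 2.6] -/
theorem wedge_neg_right {k l : ℕ} (f : MForm I M A k) (g : MForm I M A l) : f.wedge (-g) = -f.wedge g := by
  rw [← neg_one_smul ℝ g, MForm.wedge_smul_right, neg_one_smul]

omit hU in
/-- Restriction of a wedge is the wedge with the restricted left factor. [folklore] -/
theorem restr_wedge_left {k l : ℕ} (W : Set M) (f : MForm I M A k) (g : MForm I M A l) :
    (f.wedge g).restr W = (f.restr W).wedge g := by
  funext x
  by_cases hx : x ∈ W
  · rw [MForm.restr_apply_of_mem _ hx, MForm.wedge_apply, MForm.wedge_apply, MForm.restr_apply_of_mem _ hx]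
  · rw [MForm.restr_apply_of_notMem _ hx, MForm.wedge_apply, MForm.restr_apply_of_notMem _ hx]
    exact (ContinuousAlternatingMap.zero_wedge (V := E) _).symm

omit hU in
/-- Restriction of a wedge is the wedge with the restricted right factor. [folklore] -/
theorem restr_wedge_right {k l : ℕ} (W : Set M) (f : MForm I M A k) (g : MForm I M A l) :
    (f.wedge g).restr W = f.wedge (g.restr W) := by
  funext x
  by_cases hx : x ∈ W
  · rw [MForm.restr_apply_of_mem _ hx, MForm.wedge_apply, MForm.wedge_apply, MForm.restr_apply_of_mem _ hx]
  · rw [MForm.restr_apply_of_notMem _ hx, MForm.wedge_apply, MForm.restr_apply_of_notMem _ hx]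
    exact (ContinuousAlternatingMap.wedge_zero (V := E) _).symm

omit hU in
/-- A restricted left factor restricts the right factor too. [folklore] -/
theorem restr_wedge_restr {k l : ℕ} (W : Set M) (f : MForm I M A k) (g : MForm I M A l) :
    (f.restr W).wedge (g.restr W) = (f.restr W).wedge g := by
  rw [← restr_wedge_right, restr_wedge_left, MForm.restr_restr_of_subset subset_rfl]

omit hU in
/-- Two Čech cochains of forms agree as soon as they agree at the points of the `U_J`
(off `U_J` both vanish). [folklore] -/
theorem cechForms_ext {a b : ℕ} {f g : CechForms I A U a b}
    (h : ∀ J, ∀ z ∈ cechSet U J, (f J : MForm I M A b) z = (g J : MForm I M A b) z) : f = g := by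
  funext J
  apply Subtype.ext
  funext z
  by_cases hz : z ∈ cechSet U J
  · exact h J z hz
  · rw [(f J).2.2 z hz, (g J).2.2 z hz]

/-- **Leibniz rule for `δ` against the cup product with a `δ`-CLOSED `1`-cochain**:
`δ(x ∪ y) = δx ∪ y` (the general `δ(x ∪ y) = δx ∪ y + (-1)^a x ∪ δy`, Bott–Tu (1982), with
`δy = 0` on the back triangle). [cite: BottTu1982Forms, §8 (8.4)] -/
theorem cechδ_cupOne {a c : ℕ} (x : CechForms I A U a c) {y : CechForms I A U 1 1}
    (hy : cechδ I A hU 1 1 y = 0) :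
    cechδ I A hU (a + 1) (c + 1) (cupOne hU x y) = cupOne hU (cechδ I A hU a c x) y := by
  funext J'
  apply Subtype.ext
  have hsub3 : cechSet U J' ⊆ cechSet U (Cech.backThree a J') :=
    cechSet_subset_comp U J' (Fin.natAdd a (m := 3))
  have hsubf : cechSet U J' ⊆ cechSet U (J' ∘ Fin.castSucc) := cechSet_subset_comp U J' Fin.castSucc
  have hsubj : ∀ j, cechSet U J' ⊆ cechSet U (J' ∘ Fin.succAbove j) := fun j ↦ cechSet_subset_comp U J' _
  -- non-dependent names for the components of `x` and `y` (so that `simp` may re-index them)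
  let X : (Fin (a + 1) → κ) → MForm I M A c := fun T ↦ (x T : MForm I M A c)
  let Yf : (Fin 2 → κ) → MForm I M A 1 := fun T ↦ (y T : MForm I M A 1)
  have hX : ∀ T, (x T : MForm I M A c) = X T := fun _ ↦ rfl
  have hY : ∀ T, (y T : MForm I M A 1) = Yf T := fun _ ↦ rfl
  have hrr : ∀ (j : Fin (a + 1 + 2)) (α : MForm I M A c),
      (α.restr (cechSet U (J' ∘ Fin.succAbove j))).restr (cechSet U J') = α.restr (cechSet U J') :=
    fun j α ↦ MForm.restr_restr_of_subset (hsubj j) α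
  have hrrf : ∀ α : MForm I M A c,
      (α.restr (cechSet U (J' ∘ Fin.castSucc))).restr (cechSet U J') = α.restr (cechSet U J') :=
    fun α ↦ MForm.restr_restr_of_subset hsubf α
  have hrr3 : ∀ α : MForm I M A 1,
      (α.restr (cechSet U (Cech.backThree a J'))).restr (cechSet U J') = α.restr (cechSet U J') :=
    fun α ↦ MForm.restr_restr_of_subset hsub3 α
  -- `δy = 0` on the back triangle, restricted to `U_{J'}`
  have hy0 : ((cechδ I A hU 1 1 y (Cech.backThree a J') : MForm I M A 1)).restr (cechSet U J') = 0 := by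
    rw [hy]
    exact MForm.restr_zero _
  rw [coe_cechδ_apply, MForm.restr_sum, Fin.sum_univ_three] at hy0
  simp only [hY, MForm.restr_neg, hrr3, Fin.val_zero, Fin.val_one, Fin.val_two, pow_zero, pow_one, one_smul,
    neg_smul, neg_one_sq] at hy0
  have hy1 : (Yf (Cech.backThree a J' ∘ Fin.succAbove 1)).restr (cechSet U J') =
      (Yf (Cech.backThree a J' ∘ Fin.succAbove 0)).restr (cechSet U J') +
        (Yf (Cech.backThree a J' ∘ Fin.succAbove 2)).restr (cechSet U J') := by
    rw [← sub_eq_zero]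
    have e : (Yf (Cech.backThree a J' ∘ Fin.succAbove 1)).restr (cechSet U J') -
        ((Yf (Cech.backThree a J' ∘ Fin.succAbove 0)).restr (cechSet U J') +
          (Yf (Cech.backThree a J' ∘ Fin.succAbove 2)).restr (cechSet U J')) =
        -((Yf (Cech.backThree a J' ∘ Fin.succAbove 0)).restr (cechSet U J') +
          -(Yf (Cech.backThree a J' ∘ Fin.succAbove 1)).restr (cechSet U J') +
          (Yf (Cech.backThree a J' ∘ Fin.succAbove 2)).restr (cechSet U J')) := by abel
    rw [e, hy0, neg_zero]
  -- the key consequence for the wedges with the front-front factor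
  have key : ((X ((J' ∘ Fin.castSucc) ∘ Fin.castSucc)).restr (cechSet U J')).wedge
        (Yf (Cech.backThree a J' ∘ Fin.succAbove 1)) =
      ((X ((J' ∘ Fin.castSucc) ∘ Fin.castSucc)).restr (cechSet U J')).wedge
          (Yf (Cech.backThree a J' ∘ Fin.succAbove 0)) +
        ((X ((J' ∘ Fin.castSucc) ∘ Fin.castSucc)).restr (cechSet U J')).wedge
          (Yf (Cech.backThree a J' ∘ Fin.succAbove 2)) := by
    rw [← restr_wedge_restr, hy1, MForm.wedge_add_right, restr_wedge_restr, restr_wedge_restr]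
  -- expand both sides
  rw [coe_cechδ_apply]
  change _ = (((cechδ I A hU a c x (J' ∘ Fin.castSucc) : MForm I M A c)).restr (cechSet U J')).wedge
    (y (Cech.back (a + 1) J') : MForm I M A 1)
  rw [coe_cechδ_apply, MForm.restr_sum, sum_wedge]
  simp only [coe_cupOne, hX, hY, restr_wedge_left, MForm.restr_smul, hrr, hrrf, MForm.wedge_smul_left]
  rw [Fin.sum_univ_castSucc, Fin.sum_univ_castSucc, Fin.sum_univ_castSucc (n := a + 1)]
  simp only [front_comp_succAbove_castSucc, Cech.back_comp_succAbove_castSucc_castSucc,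
    back_succ_eq_backThree, back_comp_succAbove_castSucc_last, back_comp_castSucc, Fin.succAbove_last,
    Fin.val_castSucc, Fin.val_last, key, smul_add, pow_succ, mul_neg_one, neg_neg, neg_smul]
  abel

/-- **Leibniz rule for `δ` against the cup product of a `δ`-CLOSED `0`-cochain with a `0`-cochain**:
`δ(x ∪ y) = x ∪ δy` (Bott–Tu (1982)). [cite: BottTu1982Forms, §8 (8.4)] -/
theorem cechδ_cupZero {c : ℕ} {x : CechForms I A U 0 c} (hx : cechδ I A hU 0 c x = 0)
    (y : CechForms I A U 0 1) :
    cechδ I A hU 0 (c + 1) (cupZero x y) = cupOne hU x (cechδ I A hU 0 1 y) := by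
  funext J'
  apply Subtype.ext
  have hx0 : ((cechδ I A hU 0 c x J' : MForm I M A c)).restr (cechSet U J') = 0 := by
    rw [hx]
    exact MForm.restr_zero _
  rw [coe_cechδ_apply, MForm.restr_sum, Fin.sum_univ_castSucc, Fin.sum_univ_one, Fin.succAbove_last] at hx0
  simp only [MForm.restr_neg, MForm.restr_restr_of_subset subset_rfl, Fin.castSucc_zero, Fin.val_zero,
    Fin.val_last, pow_zero, pow_one, one_smul, neg_smul, add_neg_eq_zero, Fin.succAbove_zero] at hx0
  rw [coe_cechδ_apply]
  change _ = (((x (J' ∘ Fin.castSucc) : MForm I M A c)).restr (cechSet U J')).wedge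
    (cechδ I A hU 0 1 y (Cech.back 0 J') : MForm I M A 1)
  rw [back_zero, coe_cechδ_apply, Fin.sum_univ_castSucc, Fin.sum_univ_one, Fin.sum_univ_castSucc,
    Fin.sum_univ_one, Fin.succAbove_last]
  simp only [coe_cupZero, restr_wedge_left, Fin.castSucc_zero, Fin.val_zero, Fin.val_last, pow_zero, pow_one,
    one_smul, neg_smul, Fin.succAbove_zero, hx0, MForm.wedge_add_right, wedge_neg_right, restr_wedge_restr]

variable [IsManifold I ∞ M]

/-- **Leibniz rule for `d` against the cup product with a `d`-CLOSED `1`-cochain**, with the signs of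
the vertical differential `cechd = (-1)^a d`: `cechd (x ∪ y) = -(cechd x) ∪ y` (pointwise Leibniz rule
`d(α ∧ β) = dα ∧ β ± α ∧ dβ`, Warner (1983), Thm. 2.20, with `dβ = 0`). [cite: WarnerGTM94, Thm. 2.20] -/
theorem cechd_cupOne {a c : ℕ} (x : CechForms I A U a c) {y : CechForms I A U 1 1}
    (hy : ∀ T, localD I A 1 (isOpen_cechSet hU T) (y T) = 0) :
    cechd I A hU (a + 1) (c + 1) (cupOne hU x y) = -cupOne hU (cechd I A hU a c x) y := by
  refine cechForms_ext fun J z hz ↦ ?_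
  have hzf : z ∈ cechSet U (J ∘ Fin.castSucc) := cechSet_subset_comp U J Fin.castSucc hz
  have hzb : z ∈ cechSet U (Cech.back a J) := cechSet_subset_comp U J (Fin.natAdd a (m := 2)) hz
  have hαz : (((x (J ∘ Fin.castSucc) : MForm I M A c).restr (cechSet U J))).SmoothAt z :=
    (MForm.smoothAt_restr_iff (isOpen_cechSet hU J) _ hz).2 ((x _).2.1 z hzf)
  have hβz : (y (Cech.back a J) : MForm I M A 1).SmoothAt z := (y _).2.1 z hzb
  have hdy0 : ((((x (J ∘ Fin.castSucc) : MForm I M A c).restr (cechSet U J))).wedge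
      (mextDeriv (y (Cech.back a J) : MForm I M A 1))) z = 0 := by
    rw [MForm.wedge_apply, ← localD_apply_of_mem (isOpen_cechSet hU _) (y (Cech.back a J)) hzb, hy]
    exact ContinuousAlternatingMap.wedge_zero _
  rw [cechd_apply, Submodule.coe_smul, Pi.smul_apply, localD_apply_of_mem _ _ hz]
  change (-1 : ℝ) ^ (a + 1) • mextDeriv ((((x (J ∘ Fin.castSucc) : MForm I M A c).restr
    (cechSet U J))).wedge (y (Cech.back a J) : MForm I M A 1)) z = _
  rw [mextDeriv_wedge_apply_of_smoothAt hαz hβz, MForm.castDeg_eq_self, Pi.smul_apply, hdy0, smul_zero,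
    add_zero, Pi.neg_apply, Submodule.coe_neg, Pi.neg_apply]
  change _ = -(((((cechd I A hU a c x (J ∘ Fin.castSucc) : MForm I M A (c + 1))).restr
    (cechSet U J)).wedge (y (Cech.back a J) : MForm I M A 1)) z)
  rw [cechd_apply, Submodule.coe_smul, MForm.restr_smul, MForm.wedge_smul_left, Pi.smul_apply, ← neg_smul,
    pow_succ, mul_neg_one]
  congr 1
  rw [MForm.wedge_apply, MForm.wedge_apply, mextDeriv_restr_apply (isOpen_cechSet hU J) _ hz,
    MForm.restr_apply_of_mem _ hz, localD_apply_of_mem _ _ hzf]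

/-- **The bottom of the product zig-zag**: `d(s • rθ ∪ α) = s • rθ ∪ dα = s • θ ∧ θ'` at a point of
`U_i` where `rθ = θ`, `d rθ = 0` and `dα = θ'` (pointwise Leibniz rule, Warner (1983), Thm. 2.20).
Stated for an arbitrary degree `N` with `(-1)^N = 1`. [cite: WarnerGTM94, Thm. 2.20] -/
theorem cechd_smul_cupZero_apply {N : ℕ} (R : CechForms I A U 0 N) (α : CechForms I A U 0 1) (s : ℝ)
    {J : Fin 1 → κ} {z : M} (hz : z ∈ cechSet U J) (θ : MForm I M A N) (θ' : MForm I M A (2 * 0 + 1 + 1))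
    (hR : (R J : MForm I M A N) z = θ z) (hRd : mextDeriv (R J : MForm I M A N) z = 0)
    (hα : mextDeriv (α J : MForm I M A 1) z = θ' z) (hN : ((-1 : ℝ) ^ N) = 1) :
    (cechd I A hU 0 (N + 1) (s • cupZero R α) J : MForm I M A (N + 1 + 1)) z = (s • θ.wedge θ') z := by
  have h1 : ((mextDeriv (R J : MForm I M A N)).wedge (α J : MForm I M A 1)) z =
      (0 : MForm I M A (N + 1 + 1)) z := by
    rw [MForm.wedge_apply, hRd, Pi.zero_apply]
    exact ContinuousAlternatingMap.zero_wedge _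
  rw [LinearMap.map_smul, Pi.smul_apply, Submodule.coe_smul, Pi.smul_apply, cechd_apply, pow_zero, one_smul,
    localD_apply_of_mem _ _ hz, coe_cupZero, mextDeriv_wedge_apply_of_smoothAt ((R J).2.1 z hz) ((α J).2.1 z hz),
    MForm.castDeg_apply_eq _ h1, MForm.castDeg_zero, Pi.zero_apply, zero_add, Pi.smul_apply, hN, one_smul,
    MForm.wedge_apply, hR, hα, Pi.smul_apply, MForm.wedge_apply]

end Forms

end CupStep

/-- STUB `stub_cupStepForms` (registered sub-goal of item stmt-HodgeConjecture-18702, anchoring this helper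
file): **the Leibniz rule `δ(x ∪ y) = δx ∪ y` of the Čech–de Rham cup product with a `δ`-closed
`1`-cochain** (`CupStep.cechδ_cupOne`). [cite: BottTu1982Forms, §8 (8.4)] -/
theorem stub_cupStepForms : ∀ {E : Type*} [NormedAddCommGroup E] [NormedSpace ℝ E] {H : Type*} [TopologicalSpace H] {I : ModelWithCorners ℝ E H} {M : Type*} [TopologicalSpace M] [ChartedSpace H M] {A : Type*} [NormedCommRing A] [NormedAlgebra ℝ A] {κ : Type*} {U : κ → Set M} (hU : ∀ i, IsOpen (U i)) {a c : ℕ} (x : CechForms I A U a c) {y : CechForms I A U 1 1}, cechδ I A hU 1 1 y = 0 → cechδ I A hU (a + 1) (c + 1) (CupStep.cupOne hU x y) = CupStep.cupOne hU (cechδ I A hU a c x) y := by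
  intros
  exact CupStep.cechδ_cupOne _ _ ‹_›

end Summit.HodgeConjecture.HodgeConjecture.Theorems.SymbolLiftR
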